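import Literature.MathematicalPhysics.QuantumFieldTheory.Balaban1983to89.B12FormatPlus
import Literature.MathematicalPhysics.QuantumFieldTheory.Balaban1983to89.B13
import Literature.MathematicalPhysics.QuantumFieldTheory.Balaban1983to89.B13Term214
import Literature.MathematicalPhysics.QuantumFieldTheory.Balaban1983to89.Node00.BackgroundActionT

/-!
# LENS-2 (gen 5) — the ZERO-INPUT SPLIT's fixed-scale piece (L♭): CRIT-1's pending «one reading claim» (U-c) settled IN KERNEL at the
# three typed levels of the tree's [II] chain; (L♭) typed as a level-indexed item with its chain to the wall; the record-side real
# interpolation that anchors the `z`-family; separation ∕ firing models (rule (N))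

Unit `ymgap-nodeO-lens-2-g5` (LENS IDEATOR 2, lens (ii) «RG map as a flow on a space of formats»), crux K0⁷ `stmt-QuantumFields-20541`,
target = record stub 2′ `K0V23Defs.stub_absBetaBoxAtThm1WitnessCCMGenGridGZB13` via the typer's wall item 27930‴ (uniform-in-k `FP.FormatPlus`
of the record's pieces).  Continuation of the tree files `Cruxes/Record13SepCoPHInhabited/Lens2G4ZeroInputSplitSketch.lean` (Sketch v7) and
`…/Lens2G4ZeroInputTermDefs.lean` (DN0 precheck v3); those crux modules are outside the farm build (import ⇒ `remote:stale:unbuilt`), so the few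
declarations of theirs this file needs are re-declared VERBATIM in §2–§3 (marked «twin of …»), nothing else is copied.

CRIT-1's verdict on gen 4 (HOME STATUS l.3551 (4)): the Schwarz route (L♭) is «M, print-derived, ONE READING CLAIM PENDING» — U-c: *the step
accepts COMPLEX multiples `z·𝐄_k` of the history with `|z|·E < Ē′` and its output pieces are analytic in `z`; history enters only through
Lemma 1's linear analytic image `V′_k` ((1.33)–(1.36) p. 9); `P^{(k)}`, `Q` history-free; no one-sided bound on `Re V′_k` used anywhere in
(2.1), (2.15)–(2.26)*.  WHAT THIS FILE PROVES (kernel, 0 sorry):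

* §1 U-c AT THE TREE's TYPED LEVELS of [Balaban1988RG2Cluster].  (a) `bound136_histMul` — the (1.36) row `B13.Bound136` is a MODULUS bound
  LINEAR in the format letter `E₀` (`B13.lean` :343–347): for any complex `z` with `‖z‖·E₀ ≤ E′` the scaled history image `z·V″` obeys (1.36)
  with the constants `c.withE₀ E′` (every other letter of `B13.Consts` unchanged); `lemma1Printed_histMul` ∕ `lemma2Printed_histMul` — the
  whole typed content of Lemmas 1–2 (`B13.Lemma1Printed`, `B13.Lemma2Printed` :355–384: analyticity, (1.42), (1.43), (1.36), gauge
  invariance) is CLOSED under the history multiplier (`Q`, `quadForm` untouched; (1.43)'s constant is `E₀`-free), given only that the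
  reader-owned predicates `S.Analytic`, `S.GaugeInv` are closed under `f ↦ w·f` and `(f, g) ↦ f + w·g` — NO reality ∕ positivity binder
  touches `Vp ∕ Vpp ∕ V` in the carrier.  (b) `F214_histMul_eq` ∕ `F214_histMul_differentiable` — in the last line of (2.14)
  (`B13Term214.F214` :408, `cexp (∑ τ(Y)·V(Y, B))`) a history multiplier `z` on the `V″`-part is ONE complex factor `cexp (z·Σ τ(Y)V″(Y,B))`:
  the printed integrand is ENTIRE in `z` — `z` rides on print's own complex interpolation parameters `τ(Y)` ((2.18) p. 16).
  (c) `shape220_histMul` — the (2.20)-shape modulus hypothesis `h220R` of `B13Lemma3TorusPrimitive.h226_torus_of_primitives` (:226,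
  `Σ_Y |τ(Y)|·‖V(Y,B)‖ ≤ a₂₀/2·q(B) + w`) is closed under `V ↦ V_q + z·V_h` with constants `(a_q + ρ a_h, w_q + ρ w_h)`, `‖z‖ ≤ ρ`.
  (d) PRINT's SLOPE: `C3act_withE₀` — the activity constant `C3act = 2(L+2)⁴A₁(E₀K₀)` (:183) at scale `E′` is `E′`-LINEAR, so the Schwarz
  slope of the (2.41) output `ρ♭ := 2·A₂·C3act(E′)·ε₁ ∕ E′ = 4(L+2)⁴A₁A₂K₀ε₁` is `E′`-FREE (`schwarzSlope_eq`), and `ρ♭ ≤ 1 ↔ R23 at scale E′`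
  (`schwarzSlope_le_one_iff`, `B13.Consts.R23` :214) — the closure letter of the split is print's restriction R23, no new letter.
* §2 (L♭) AS A TYPED, LEVEL-INDEXED ITEM over abstract record data (v8.1: + `flat_of_dChannelContraction` — (L) ⟹ (L♭) by the
  trivial linear family, CRIT-1 l.3594: at statement level (L♭) ≅ (L), its value is as the PROOF ROUTE; v8.2: + `formatPlusG_add` ∕
  `formatPlusG_of_split` — the split recombines in the vehicle of record `FormatPlusG` (B12FormatPlus v3 ✓p791826) row for row) (every `record…` name a variable, as in Sketch v7 §2): `DChannelFlat`
  (for every level `k`, admissible history `v`, history format level `0 < E < Ē′` reached by all previous levels: a `z`-family of piece systems,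
  differentiable in `z` on the disc `|z| < Ē′/E` at every admissible coordinate point, uniformly (1.18)-bounded by ONE constant `C` there,
  vanishing at `z = 0`, whose `z = 1` member carries the four other rows for `Φ k v − Φz k v`); `dChannelContraction_of_flat` — (L♭) ⟹ (L) with
  `ρ := C ∕ Ē′` for every `Ē < Ē′` (Schwarz, `bound118_of_schwarz`, CRIT-1 typing note (a): `0 < E ≤ Ē < Ē′`); `FlatSplitItem` = ONE `∃ σ Ē Ē′ C`
  with guards `0 < σ`, `0 ≤ C < Ē′`, `0 < Ē < Ē′`, closure `σ ≤ (1 − C/Ē′)·Ē`, conjuncts (Z) ∧ (L♭); `wall_of_flatSplitItem` — it implies the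
  wall's body with `E₀ := σ ∕ (1 − C/Ē′)` (full-memory Grönwall of v7, re-declared).
* §3 RECORD SIDE (imports `Node00.BackgroundActionT`; twins of DN0 precheck v3 §1–§2): the REAL interpolation `histInterpT t := R_k(A⁰_k + t·𝐄_k)`
  through the ONE step functional `stepOutT` with explicit input action; `histInterpT_one : … 1 = mergedTermT …` (𝓝_{k+1}),
  `histInterpT_zero : … 0 = stepOutT … (mainTermT …)` (𝓝⁰_{k+1}); `dChannelInterpT t := histInterpT t − histInterpT 0` with
  `dChannelInterpT_zero = 0` and `dChannelInterpT_one = 𝓝 − 𝓝⁰` — the real segment on which (L♭)'s `z`-family is ANCHORED to the record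
  (identity theorem: a `z`-analytic family agreeing with `t ↦ 𝓓_{k+1}(t)` on `(−Ē′/E, Ē′/E)` is unique).  Definitions + `simp`/`ring` only.
* §4 MODELS (rule (N), addendum №403): Toy D — (Z), (L♭) and the flat item hold NON-VACUOUSLY in the toy mould and the chain fires
  (`toyD_flat`, `toyD_flatSplitItem`, `toyD_wall`); Toy A♭ — the WALL and (Z) hold while the flat item FAILS (`toyA_not_flatSplitItem`, by the
  Schwarz lemma itself): the wall does NOT inhabit (L♭) — (L♭) is not 2′∕27930‴ in costume for this typing.

HONEST FRAMING.  Bookkeeping over the Literature carriers only.  §1 shows that the HYPOTHESIS SHAPES the tree gives [II]'s Lemmas 1–3 are closed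
under a complex history multiplier and that (2.14)'s last line is entire in it; it does NOT prove Lemma 1 ((1.33)–(1.36)), Lemma 3 ((2.26) ⇒
(2.38)) or the [26]-step for anything, least of all for the record; the `z`-analyticity of the KP-resummed output `E^{(k+1)}(X)(z)` on the disc is
print-native (p. 15 «the activities in (2.13), and the whole sum E^{(k+1)}(X), are analytic functions», KP region uniform in `z` by (2.38) at
scale `Ē′`) but UNPORTED.  (Z), (L), (L♭) are [support]-shaped sub-targets of 27930‴, never replacements; 27930–27932 OPEN and UNSIGNED; stub 2′
OPEN; K0⁷ NOT closed; NODE O not inhabited; COUNT 8∕28 · K 1∕4 unmoved; finite 𝕋⁴ at fixed ε — NOT continuum ∕ OS ∕ Clay; the Yang–Mills mass gap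
is NOT proved by any of this.  No `sorry`, no `instance`, no `notation`, no new axiom, no `set_option allowUnsafeReducibility`.
-/

namespace Summit.QuantumFields.YangMills.Cruxes.Record13SepCoPHInhabited.Lens2G5

open Literature.MathematicalPhysics.QuantumFieldTheory.Balaban1983to89
open Literature.MathematicalPhysics.QuantumFieldTheory.Balaban1983to89.B12FormatPlus
open _root_.Filter _root_.Topology

noncomputable section

/-! ## §1. U-c in kernel: the tree's typed [II] inputs are closed under a complex history multiplier -/

section UcConsts

/-- The constants of [II] with the format letter `E₀` set to `E'`, every other letter kept. [cite: Balaban1988RG2Cluster, §§1–2 (constants)] -/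
def withE₀ (c : B13.Consts) (E' : ℝ) : B13.Consts := { c with E₀ := E' }

@[simp] theorem withE₀_E₀ (c : B13.Consts) (E' : ℝ) : (withE₀ c E').E₀ = E' := rfl
@[simp] theorem withE₀_ε₁ (c : B13.Consts) (E' : ℝ) : (withE₀ c E').ε₁ = c.ε₁ := rfl
@[simp] theorem withE₀_A₂ (c : B13.Consts) (E' : ℝ) : (withE₀ c E').A₂ = c.A₂ := rfl
@[simp] theorem withE₀_L (c : B13.Consts) (E' : ℝ) : (withE₀ c E').L = c.L := rfl

/-- The `E₀`-free kernel `K₀` is unchanged. [cite: Balaban1988RG2Cluster, p.19 (definition of ε₂)] -/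
@[simp] theorem K₀_withE₀ (c : B13.Consts) (E' : ℝ) : (withE₀ c E').K₀ = c.K₀ := rfl

/-- `ε₂ = E₀ε₁K₀` at scale `E'` (linear in the scale). [cite: Balaban1988RG2Cluster, p.19] -/
theorem eps2_withE₀ (c : B13.Consts) (E' : ℝ) : (withE₀ c E').eps2 = E' * c.ε₁ * c.K₀ := rfl

/-- **The activity constant at scale `E'` is `E'`-LINEAR**: `C3act(E') = 2(L+2)⁴A₁·(E'·K₀)`. [cite: Balaban1988RG2Cluster, p.20 (C₃ of (2.38))] -/
theorem C3act_withE₀ (c : B13.Consts) (E' : ℝ) : (withE₀ c E').C3act = 2 * ((c.L : ℝ) + 2) ^ 4 * c.A₁ * (E' * c.K₀) := rfl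

/-- **The Schwarz slope of the (2.41) output is scale-free**: `2·A₂·C3act(E')·ε₁ / E' = 4(L+2)⁴A₁A₂K₀ε₁` (the factor 2 is the price of
`D(z) = out(z) − out(0)`). [cite: Balaban1988RG2Cluster, (2.41) p.21 with C₃ ∝ E₀ p.20] -/
theorem schwarzSlope_eq (c : B13.Consts) {E' : ℝ} (hE' : E' ≠ 0) :
    2 * ((withE₀ c E').A₂ * (withE₀ c E').C3act * (withE₀ c E').ε₁) / E' =
      4 * ((c.L : ℝ) + 2) ^ 4 * c.A₁ * c.A₂ * c.K₀ * c.ε₁ := by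
  rw [C3act_withE₀, withE₀_A₂, withE₀_ε₁]
  field_simp
  ring

/-- **The split's closure letter is print's R23**: slope `≤ 1` iff `A₂·C3act(E')·ε₁ ≤ E'/2`, i.e. `B13.Consts.R23` at scale `E'`.
[cite: Balaban1988RG2Cluster, p.21 "O(1)C₃ε₁ ≤ ½E₀" (R23)] -/
theorem schwarzSlope_le_one_iff (c : B13.Consts) {E' : ℝ} (hE' : 0 < E') :
    2 * ((withE₀ c E').A₂ * (withE₀ c E').C3act * (withE₀ c E').ε₁) / E' ≤ 1 ↔ (withE₀ c E').R23 := by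
  rw [B13.Consts.R23, withE₀_E₀, div_le_iff₀ hE']
  constructor <;> intro h <;> linarith

end UcConsts

section UcStep

/-- **U-c for the (1.36) row.**  `B13.Bound136` is a modulus bound linear in `E₀`: a complex history multiplier `z` with `‖z‖·E₀ ≤ E'`
keeps (1.36) with the constants at scale `E'`. [cite: Balaban1988RG2Cluster, (1.36) p.9] -/
theorem bound136_histMul (S : B13.StepData) (c : B13.Consts) (F : S.Dk.Dom → S.Φ → ℂ) (z : ℂ) {E' : ℝ}
    (h : B13.Bound136 S c F) (hz : ‖z‖ * c.E₀ ≤ E') (hε : 0 ≤ c.ε₁) (hC : 0 ≤ c.C₁) (hM : 0 ≤ c.M ^ c.q) :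
    B13.Bound136 S (withE₀ c E') (fun Y φ => z * F Y φ) := by
  intro Y φ hφ
  have h1 := h Y φ hφ
  have hK : 0 ≤ c.ε₁ * c.C₁ * c.M ^ c.q * Real.exp (c.C₂ * c.κ₁) *
      Real.exp (-((1 - 2 * c.δ) * c.κ * S.Dk.dj Y)) :=
    mul_nonneg (mul_nonneg (mul_nonneg (mul_nonneg hε hC) hM) (Real.exp_nonneg _)) (Real.exp_nonneg _)
  show ‖z * F Y φ‖ ≤ E' * c.ε₁ * c.C₁ * c.M ^ c.q * Real.exp (c.C₂ * c.κ₁) *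
      Real.exp (-((1 - 2 * c.δ) * c.κ * S.Dk.dj Y))
  rw [norm_mul]
  calc ‖z‖ * ‖F Y φ‖
      ≤ ‖z‖ * (c.E₀ * c.ε₁ * c.C₁ * c.M ^ c.q * Real.exp (c.C₂ * c.κ₁) *
          Real.exp (-((1 - 2 * c.δ) * c.κ * S.Dk.dj Y))) := mul_le_mul_of_nonneg_left h1 (norm_nonneg z)
    _ = (‖z‖ * c.E₀) * (c.ε₁ * c.C₁ * c.M ^ c.q * Real.exp (c.C₂ * c.κ₁) *
          Real.exp (-((1 - 2 * c.δ) * c.κ * S.Dk.dj Y))) := by ring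
    _ ≤ E' * (c.ε₁ * c.C₁ * c.M ^ c.q * Real.exp (c.C₂ * c.κ₁) *
          Real.exp (-((1 - 2 * c.δ) * c.κ * S.Dk.dj Y))) := mul_le_mul_of_nonneg_right hz hK
    _ = _ := by ring

/-- **The [II] step data with the HISTORY CHANNEL multiplied by `z`**: `V′ ↦ z·V′`, `V″ ↦ z·V″`, `V ↦ V + (z − 1)·V″` (`= ½⟨Q B, B⟩ + z·V″`
on the space (1.34) by (1.42); `Q`, the main action's form, untouched); domains, spaces, outputs, predicates kept.  (The outputs `H`, `Ek1`,
`Elog` are carrier data, not functions of the inputs — §1 is about the INPUT rows only.) [cite: Balaban1988RG2Cluster, (1.33), (1.41)–(1.42) pp.9–11] -/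
def histMul (S : B13.StepData) (z : ℂ) : B13.StepData :=
  { S with
    Vp := fun Y φ => z * S.Vp Y φ
    Vpp := fun Y φ => z * S.Vpp Y φ
    V := fun Y φ => S.V Y φ + (z - 1) * S.Vpp Y φ }

/-- The quadratic form (1.42) is untouched by the history multiplier (definitionally). -/
theorem histMul_quadForm (S : B13.StepData) (z : ℂ) (Y : S.Dk.Dom) (φ : S.Φ) :
    (histMul S z).quadForm Y φ = S.quadForm Y φ := rfl

/-- **U-c for Lemma 1's typed content** (analyticity of `V′` on (1.34) ∧ (1.36)): closed under the history multiplier at scale `E' ≥ ‖z‖E₀`,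
given closure of the reader-owned analyticity predicate under scalar multiples. [cite: Balaban1988RG2Cluster, Lemma 1 p.9] -/
theorem lemma1Printed_histMul (S : B13.StepData) (c : B13.Consts) (z : ℂ) {E' : ℝ} (h1 : B13.Lemma1Printed S c)
    (hz : ‖z‖ * c.E₀ ≤ E') (hε : 0 ≤ c.ε₁) (hC : 0 ≤ c.C₁) (hM : 0 ≤ c.M ^ c.q)
    (hAsmul : ∀ (f : S.Φ → ℂ) (s : Set S.Φ) (w : ℂ), S.Analytic f s → S.Analytic (fun φ => w * f φ) s) :
    B13.Lemma1Printed (histMul S z) (withE₀ c E') := by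
  refine ⟨fun Y => hAsmul (S.Vp Y) (S.sp1 Y) z (h1.1 Y), ?_⟩
  intro Y φ hφ
  exact bound136_histMul S c S.Vp z h1.2 hz hε hC hM Y φ hφ

/-- **U-c for Lemma 2's typed content** (analyticity of `V`, (1.42), (1.43), (1.36) for `V″`, gauge invariance of `V`, `½⟨QB,B⟩`, `V″`):
CLOSED under the history multiplier at scale `E' ≥ ‖z‖E₀` — (1.43)'s constant `C₃ε₁M⁴e^{C₂κ₁}` is `E₀`-free and `Q` is untouched; (1.36)
by `bound136_histMul`; the rest by closure of the reader-owned predicates under `f + w·g` and `w·f`.  No reality or positivity property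
of `V′, V″, V` is a field of the carrier, so none can be violated. [cite: Balaban1988RG2Cluster, Lemma 2 p.11] -/
theorem lemma2Printed_histMul (S : B13.StepData) (c : B13.Consts) (z : ℂ) {E' : ℝ}
    (h1 : B13.Lemma1Printed S c) (hVpp : S.Vpp = S.Vp) (h2 : B13.Lemma2Printed S c)
    (hz : ‖z‖ * c.E₀ ≤ E') (hε : 0 ≤ c.ε₁) (hC : 0 ≤ c.C₁) (hM : 0 ≤ c.M ^ c.q)
    (hAadd : ∀ (f g : S.Φ → ℂ) (s : Set S.Φ) (w : ℂ), S.Analytic f s → S.Analytic g s →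
      S.Analytic (fun φ => f φ + w * g φ) s)
    (hGsmul : ∀ (f : S.Φ → ℂ) (w : ℂ), S.GaugeInv f → S.GaugeInv (fun φ => w * f φ))
    (hGadd : ∀ (f g : S.Φ → ℂ) (w : ℂ), S.GaugeInv f → S.GaugeInv g → S.GaugeInv (fun φ => f φ + w * g φ)) :
    B13.Lemma2Printed (histMul S z) (withE₀ c E') := by
  obtain ⟨hVan, hrepr, hQ, h136, hG⟩ := h2
  have hVppAn : ∀ Y, S.Analytic (S.Vpp Y) (S.sp1 Y) := fun Y => by rw [hVpp]; exact h1.1 Y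
  refine ⟨?_, ?_, ?_, ?_, ?_⟩
  · intro Y
    exact hAadd (S.V Y) (S.Vpp Y) (S.sp1 Y) (z - 1) (hVan Y) (hVppAn Y)
  · intro Y φ hφ
    show S.V Y φ + (z - 1) * S.Vpp Y φ = S.quadForm Y φ + z * S.Vpp Y φ
    rw [hrepr Y φ hφ]
    ring
  · intro Y φ b b' hφ
    exact hQ Y φ b b' hφ
  · intro Y φ hφ
    exact bound136_histMul S c S.Vpp z h136 hz hε hC hM Y φ hφ
  · intro Y
    exact ⟨hGadd (S.V Y) (S.Vpp Y) (z - 1) (hG Y).1 (hG Y).2.2, (hG Y).2.1, hGsmul (S.Vpp Y) z (hG Y).2.2⟩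

/-- For the CONCRETE analyticity predicate of the β-road mould (`AnalyticOnNhd`, `B12FormatPlus.Analytic19`) the two closure hypotheses
hold (so they are no assumption there). [folklore] -/
theorem analyticOnNhd_closure {Φ : Type*} [NormedAddCommGroup Φ] [NormedSpace ℂ Φ] :
    (∀ (f : Φ → ℂ) (s : Set Φ) (w : ℂ), AnalyticOnNhd ℂ f s → AnalyticOnNhd ℂ (fun φ => w * f φ) s) ∧
    (∀ (f g : Φ → ℂ) (s : Set Φ) (w : ℂ), AnalyticOnNhd ℂ f s → AnalyticOnNhd ℂ g s →
      AnalyticOnNhd ℂ (fun φ => f φ + w * g φ) s) :=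
  ⟨fun _ _ _ hf => analyticOnNhd_const.mul hf, fun _ _ _ _ hf hg => hf.add (analyticOnNhd_const.mul hg)⟩

end UcStep

section UcLine214

variable {Λ : Type} {D : Type*}

/-- The history exponent splits off ONE complex factor. -/
theorem sum_histMul_split (Dfam : Finset D) (Vq Vh : D → (Λ → ℝ) → ℂ) (τ : D → ℂ) (B : Λ → ℝ) (z : ℂ) :
    ∑ Y ∈ Dfam, τ Y * (Vq Y B + z * Vh Y B) =
      (∑ Y ∈ Dfam, τ Y * Vq Y B) + z * ∑ Y ∈ Dfam, τ Y * Vh Y B := by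
  rw [Finset.mul_sum, ← Finset.sum_add_distrib]
  exact Finset.sum_congr rfl fun Y _ => by ring

/-- **U-c in (2.14)'s last line**: with the potentials split as `V = V_q + z·V_h` (main-action part + multiplied history part), the printed
factor `(−1)^{|P|}χχᶜ exp[Σ τ(Y)V(Y,B)]` is the history-free factor (`V = V_q`) times ONE exponential `cexp (z·Σ τ(Y)V_h(Y,B))` — the
multiplier rides on print's complex `τ(Y)`. [cite: Balaban1988RG2Cluster, (2.14) p.15, (2.18) p.16] -/
theorem F214_histMul_eq (cardP : ℕ) (χY₀ χcP : (Λ → ℝ) → ℝ) (Dfam : Finset D) (Vq Vh : D → (Λ → ℝ) → ℂ)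
    (τ : D → ℂ) (B : Λ → ℝ) (z : ℂ) :
    B13Term214.F214 cardP χY₀ χcP Dfam (fun Y B => Vq Y B + z * Vh Y B) τ B =
      B13Term214.F214 cardP χY₀ χcP Dfam Vq τ B * Complex.exp (z * ∑ Y ∈ Dfam, τ Y * Vh Y B) := by
  simp only [B13Term214.F214]
  rw [sum_histMul_split, Complex.exp_add]
  ring

/-- **(2.14)'s last line is ENTIRE in the history multiplier.** [cite: Balaban1988RG2Cluster, (2.14) p.15] -/
theorem F214_histMul_differentiable (cardP : ℕ) (χY₀ χcP : (Λ → ℝ) → ℝ) (Dfam : Finset D) (Vq Vh : D → (Λ → ℝ) → ℂ)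
    (τ : D → ℂ) (B : Λ → ℝ) :
    Differentiable ℂ fun z : ℂ => B13Term214.F214 cardP χY₀ χcP Dfam (fun Y B => Vq Y B + z * Vh Y B) τ B := by
  have h : ∀ z : ℂ, B13Term214.F214 cardP χY₀ χcP Dfam (fun Y B => Vq Y B + z * Vh Y B) τ B =
      B13Term214.F214 cardP χY₀ χcP Dfam Vq τ B * Complex.exp (z * ∑ Y ∈ Dfam, τ Y * Vh Y B) :=
    fun z => F214_histMul_eq cardP χY₀ χcP Dfam Vq Vh τ B z
  simp_rw [h]
  exact (differentiable_const _).mul ((differentiable_id.mul (differentiable_const _)).cexp)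

/-- **U-c for the (2.20)-shape** (`h220R` of `B13Lemma3TorusPrimitive.h226_torus_of_primitives`): the modulus hypothesis
`Σ_Y R(Y)·‖V(Y,B)‖ ≤ a/2·q(B) + w` is closed under `V ↦ V_q + z·V_h`, `‖z‖ ≤ ρ`, constants `(a_q + ρ a_h, w_q + ρ w_h)`.
[cite: Balaban1988RG2Cluster, (2.19)–(2.20) p.16] -/
theorem shape220_histMul (Dfam : Finset D) (R : D → ℝ) (hR : ∀ Y, 0 ≤ R Y) (q : (Λ → ℝ) → ℝ)
    (Vq Vh : D → (Λ → ℝ) → ℂ) {aq wq ah wh ρ : ℝ} (z : ℂ) (hz : ‖z‖ ≤ ρ)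
    (hq : ∀ B, ∑ Y ∈ Dfam, R Y * ‖Vq Y B‖ ≤ aq / 2 * q B + wq)
    (hh : ∀ B, ∑ Y ∈ Dfam, R Y * ‖Vh Y B‖ ≤ ah / 2 * q B + wh) :
    ∀ B, ∑ Y ∈ Dfam, R Y * ‖Vq Y B + z * Vh Y B‖ ≤ (aq + ρ * ah) / 2 * q B + (wq + ρ * wh) := by
  intro B
  have hS : 0 ≤ ∑ Y ∈ Dfam, R Y * ‖Vh Y B‖ := Finset.sum_nonneg fun Y _ => mul_nonneg (hR Y) (norm_nonneg _)
  calc ∑ Y ∈ Dfam, R Y * ‖Vq Y B + z * Vh Y B‖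
      ≤ ∑ Y ∈ Dfam, (R Y * ‖Vq Y B‖ + ‖z‖ * (R Y * ‖Vh Y B‖)) := Finset.sum_le_sum fun Y _ => by
          have h1 : ‖Vq Y B + z * Vh Y B‖ ≤ ‖Vq Y B‖ + ‖z‖ * ‖Vh Y B‖ := by
            refine (norm_add_le _ _).trans ?_
            rw [norm_mul]
          have h2 := mul_le_mul_of_nonneg_left h1 (hR Y)
          linarith [h2]
    _ = (∑ Y ∈ Dfam, R Y * ‖Vq Y B‖) + ‖z‖ * ∑ Y ∈ Dfam, R Y * ‖Vh Y B‖ := by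
          rw [Finset.sum_add_distrib, Finset.mul_sum]
    _ ≤ (aq / 2 * q B + wq) + ρ * (ah / 2 * q B + wh) := add_le_add (hq B)
          ((mul_le_mul_of_nonneg_right hz hS).trans (mul_le_mul_of_nonneg_left (hh B) ((norm_nonneg z).trans hz)))
    _ = (aq + ρ * ah) / 2 * q B + (wq + ρ * wh) := by ring

end UcLine214

/-! ## §2. (L♭) typed as a level-indexed item; (L♭) ⟹ (L); the flat split ⟹ the wall -/

section Mould

variable {S : ℕ → LocDomainSys} {M m : ℕ → ℕ}
  {Uc : (n : ℕ) → (S n).Dom → Set (Fin (M n) → ℂ)} {coords : (n : ℕ) → (S n).Dom → Finset (Fin (M n))}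
  {χ : (n : ℕ) → (S n).Dom → (Fin (m n) → ℂ) → (Fin (M n) → ℂ)} {W : ℕ → Type*} [∀ n, TopologicalSpace (W n)]
  [∀ n, Zero (W n)] {Φ₁ Φ₂ Φf Ψ : (n : ℕ) → W n → ℂ} {ι : (n : ℕ) → W n → (Fin (m n) → ℂ)}
  {wrap : (n : ℕ) → Finset (S n).Dom} {emb : (n : ℕ) → (S n).Dom → (S (n + 1)).Dom}
  {πc : (n : ℕ) → (S n).Dom → (Fin (M (n + 1)) → ℂ) → (Fin (M n) → ℂ)} {E₁ E₂ E₀ κ : ℝ}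

/-- Pieces add (twin of Sketch v7 `formatPlus_add`). -/
theorem formatPlus_add (h₁ : FormatPlus S M Uc coords m χ Φ₁ ι wrap emb πc E₁ κ)
    (h₂ : FormatPlus S M Uc coords m χ Φ₂ ι wrap emb πc E₂ κ) :
    FormatPlus S M Uc coords m χ (fun n B => Φ₁ n B + Φ₂ n B) ι wrap emb πc (E₁ + E₂) κ := by
  obtain ⟨P, hA, hB, hL, hR, hV⟩ := h₁
  obtain ⟨Q, hA', hB', hL', hR', hV'⟩ := h₂
  refine ⟨fun n X u => P n X u + Q n X u, ?_, ?_, ?_, ?_, ?_⟩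
  · intro n X
    exact (hA n X).add (hA' n X)
  · intro n X u hu
    calc ‖P n X u + Q n X u‖ ≤ ‖P n X u‖ + ‖Q n X u‖ := norm_add_le _ _
      _ ≤ E₁ * Real.exp (-κ * (S n).dj X) + E₂ * Real.exp (-κ * (S n).dj X) :=
          add_le_add (hB n X u hu) (hB' n X u hu)
      _ = (E₁ + E₂) * Real.exp (-κ * (S n).dj X) := by ring
  · intro n X u u' h
    exact congrArg₂ (· + ·) (hL n X u u' h) (hL' n X u u' h)
  · intro n
    filter_upwards [hR n, hR' n] with B h1 h2
    rw [h1, h2, ← Finset.sum_add_distrib]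
  · intro n X hX u'
    exact congrArg₂ (· + ·) (hV n X hX u') (hV' n X hX u')

/-- **The (1.19) row adds** — 27930⁗'s vehicle `FormatPlusG` = `FormatPlus` + `GaugeInv119` (PRINT-ROAD rev 3 §7.1): the split glue
carries over verbatim with the (1.19) row appended to (Z) and to (L♭)'s `z = 1` member. [cite: Balaban1987RG1, (1.19) p.263] -/
theorem gaugeInv119_add {G : ℕ → Type*} {act : (n : ℕ) → G n → (Fin (M n) → ℂ) → (Fin (M n) → ℂ)} {P Q : Pieces S M}
    (hP : GaugeInv119 act Uc P) (hQ : GaugeInv119 act Uc Q) :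
    GaugeInv119 act Uc (fun n X u => P n X u + Q n X u) :=
  ⟨hP.1, fun n g X u => congrArg₂ (· + ·) (hP.2 n g X u) (hQ.2 n g X u)⟩

/-- **Pieces add in the `FormatPlusG` vehicle itself** (B12FormatPlus v3 ✓p791826 `FormatPlusG` :460 = the five rows ∧ (1.19) for
the SAME pieces): formats add, the (1.19) row included. [cite: Balaban1987RG1, (1.18)–(1.19) p.263] -/
theorem formatPlusG_add {G : ℕ → Type*} {act : (n : ℕ) → G n → (Fin (M n) → ℂ) → (Fin (M n) → ℂ)}
    (h₁ : FormatPlusG S M act Uc coords m χ Φ₁ ι wrap emb πc E₁ κ)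
    (h₂ : FormatPlusG S M act Uc coords m χ Φ₂ ι wrap emb πc E₂ κ) :
    FormatPlusG S M act Uc coords m χ (fun n B => Φ₁ n B + Φ₂ n B) ι wrap emb πc (E₁ + E₂) κ := by
  obtain ⟨P, hA, hB, hL, hR, hV, hG⟩ := h₁
  obtain ⟨Q, hA', hB', hL', hR', hV', hG'⟩ := h₂
  refine ⟨fun n X u => P n X u + Q n X u, ?_, ?_, ?_, ?_, ?_, gaugeInv119_add hG hG'⟩
  · intro n X
    exact (hA n X).add (hA' n X)
  · intro n X u hu
    calc ‖P n X u + Q n X u‖ ≤ ‖P n X u‖ + ‖Q n X u‖ := norm_add_le _ _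
      _ ≤ E₁ * Real.exp (-κ * (S n).dj X) + E₂ * Real.exp (-κ * (S n).dj X) :=
          add_le_add (hB n X u hu) (hB' n X u hu)
      _ = (E₁ + E₂) * Real.exp (-κ * (S n).dj X) := by ring
  · intro n X u u' h
    exact congrArg₂ (· + ·) (hL n X u u' h) (hL' n X u u' h)
  · intro n
    filter_upwards [hR n, hR' n] with B h1 h2
    rw [h1, h2, ← Finset.sum_add_distrib]
  · intro n X hX u'
    exact congrArg₂ (· + ·) (hV n X hX u') (hV' n X hX u')

/-- The `FormatPlusG` mould reads only the germ at `0`. -/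
theorem formatPlusG_congr {G : ℕ → Type*} {act : (n : ℕ) → G n → (Fin (M n) → ℂ) → (Fin (M n) → ℂ)}
    (h : FormatPlusG S M act Uc coords m χ Φf ι wrap emb πc E₀ κ) (heq : ∀ n, ∀ᶠ B in 𝓝 (0 : W n), Ψ n B = Φf n B) :
    FormatPlusG S M act Uc coords m χ Ψ ι wrap emb πc E₀ κ := by
  obtain ⟨P, hA, hB, hL, hR, hV, hG⟩ := h
  refine ⟨P, hA, hB, hL, ?_, hV, hG⟩
  intro n
  filter_upwards [hR n, heq n] with B h1 h2
  rw [h2, h1]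

/-- **The split recombined in the `FormatPlusG` vehicle**: (Z) at `σ` and the history channel at `τ`, both with the (1.19) row,
give 27930⁗'s mould at `σ + τ` — so the whole §2 chain ports to the vehicle of record row for row. -/
theorem formatPlusG_of_split {G : ℕ → Type*} {act : (n : ℕ) → G n → (Fin (M n) → ℂ) → (Fin (M n) → ℂ)}
    {Φ Φz : (n : ℕ) → W n → ℂ} {σ τ : ℝ}
    (hZ : FormatPlusG S M act Uc coords m χ Φz ι wrap emb πc σ κ)
    (hD : FormatPlusG S M act Uc coords m χ (fun n B => Φ n B - Φz n B) ι wrap emb πc τ κ) :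
    FormatPlusG S M act Uc coords m χ Φ ι wrap emb πc (σ + τ) κ :=
  formatPlusG_congr (formatPlusG_add hZ hD) fun n => Filter.Eventually.of_forall fun B => by
    show Φ n B = Φz n B + (Φ n B - Φz n B)
    ring

/-- The mould reads only the germ at `0` (twin of v7 `formatPlus_congr`). -/
theorem formatPlus_congr (h : FormatPlus S M Uc coords m χ Φf ι wrap emb πc E₀ κ)
    (heq : ∀ n, ∀ᶠ B in 𝓝 (0 : W n), Ψ n B = Φf n B) :
    FormatPlus S M Uc coords m χ Ψ ι wrap emb πc E₀ κ := by
  obtain ⟨P, hA, hB, hL, hR, hV⟩ := h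
  refine ⟨P, hA, hB, hL, ?_, hV⟩
  intro n
  filter_upwards [hR n, heq n] with B h1 h2
  rw [h2, h1]

/-- The split recombined (twin of v7 `formatPlus_of_split`). -/
theorem formatPlus_of_split {Φ Φz : (n : ℕ) → W n → ℂ} {σ τ : ℝ}
    (hZ : FormatPlus S M Uc coords m χ Φz ι wrap emb πc σ κ)
    (hD : FormatPlus S M Uc coords m χ (fun n B => Φ n B - Φz n B) ι wrap emb πc τ κ) :
    FormatPlus S M Uc coords m χ Φ ι wrap emb πc (σ + τ) κ :=
  formatPlus_congr (formatPlus_add hZ hD) fun n => Filter.Eventually.of_forall fun B => by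
    show Φ n B = Φz n B + (Φ n B - Φz n B)
    ring

/-- **Schwarz ⇒ the (1.18) row contracts linearly in the history scale** (twin of v7 `bound118_of_schwarz`). [cite: Balaban1988RG2Cluster, (2.38)–(2.41) pp.20–21 (mechanism); Mathlib Schwarz lemma] -/
theorem bound118_of_schwarz {S : ℕ → LocDomainSys} {M : ℕ → ℕ} (Uc : (n : ℕ) → (S n).Dom → Set (Fin (M n) → ℂ))
    (Ez : ℂ → Pieces S M) {R C κ : ℝ} (hR : 1 < R)
    (hd : ∀ n X u, u ∈ Uc n X → DifferentiableOn ℂ (fun z => Ez z n X u) (Metric.ball 0 R))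
    (hb : ∀ z ∈ Metric.ball (0 : ℂ) R, Bound118 S Uc (Ez z) C κ)
    (h0 : ∀ n X u, u ∈ Uc n X → Ez 0 n X u = 0) :
    Bound118 S Uc (Ez 1) (C / R) κ := by
  intro n X u hu
  have h1 : (1 : ℂ) ∈ Metric.ball (0 : ℂ) R := by
    rw [Metric.mem_ball, dist_zero_right, norm_one]; exact hR
  have hmaps : Set.MapsTo (fun z => Ez z n X u) (Metric.ball 0 R)
      (Metric.closedBall ((fun z => Ez z n X u) 0) (C * Real.exp (-κ * (S n).dj X))) := by
    intro z hz
    show dist (Ez z n X u) (Ez 0 n X u) ≤ C * Real.exp (-κ * (S n).dj X)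
    rw [h0 n X u hu, dist_zero_right]
    exact hb z hz n X u hu
  have hS := Complex.dist_le_div_mul_dist_of_mapsTo_ball (hd n X u hu) hmaps h1
  have hS' : dist (Ez 1 n X u) (Ez 0 n X u) ≤ C * Real.exp (-κ * (S n).dj X) / R * dist (1 : ℂ) 0 := hS
  rw [h0 n X u hu, dist_zero_right, dist_zero_right, norm_one, mul_one] at hS'
  calc ‖Ez 1 n X u‖ ≤ C * Real.exp (-κ * (S n).dj X) / R := hS'
    _ = C / R * Real.exp (-κ * (S n).dj X) := by ring

end Mould

section Flat

variable (S : ℕ → ℕ → LocDomainSys) (M m : ℕ → ℕ → ℕ)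
  (Uc : (k n : ℕ) → (S k n).Dom → Set (Fin (M k n) → ℂ)) (coords : (k n : ℕ) → (S k n).Dom → Finset (Fin (M k n)))
  (χ : (k n : ℕ) → (S k n).Dom → (Fin (m k n) → ℂ) → (Fin (M k n) → ℂ)) (W : ℕ → ℕ → Type*)
  [∀ k n, TopologicalSpace (W k n)] [∀ k n, Zero (W k n)]
  (Φ Φz : (k : ℕ) → (Fin (k + 1) → ℝ) → (n : ℕ) → W k n → ℂ) (ι : (k n : ℕ) → W k n → (Fin (m k n) → ℂ))
  (wrap : (k n : ℕ) → Finset (S k n).Dom) (emb : (k n : ℕ) → (S k n).Dom → (S k (n + 1)).Dom)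
  (πc : (k n : ℕ) → (S k n).Dom → (Fin (M k (n + 1)) → ℂ) → (Fin (M k n) → ℂ))

/-- THE WALL's body (twin of v7 `UniformFormat`): one constant `E₀` at every level and admissible history. -/
def UniformFormat (γ₀ E₀ κ : ℝ) : Prop :=
  ∀ k v, v ∈ FlowStep.Box γ₀ k →
    FormatPlus (S k) (M k) (Uc k) (coords k) (m k) (χ k) (Φ k v) (ι k) (wrap k) (emb k) (πc k) E₀ κ

/-- PIECE (Z) (twin of v7 `ZeroInputFormat`): the zero-input functional has format `σ` at every level. -/
def ZeroInputFormat (γ₀ σ κ : ℝ) : Prop :=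
  ∀ k v, v ∈ FlowStep.Box γ₀ k →
    FormatPlus (S k) (M k) (Uc k) (coords k) (m k) (χ k) (Φz k v) (ι k) (wrap k) (emb k) (πc k) σ κ

/-- PIECE (L) (twin of v7 `DChannelContraction`): for `0 < E ≤ Ē`, format `E` of all previous levels ⟹ format `ρ·E` of `Φ k v − Φz k v`. -/
def DChannelContraction (γ₀ ρ Ē κ : ℝ) : Prop :=
  ∀ k v, v ∈ FlowStep.Box γ₀ k → ∀ E : ℝ, 0 < E → E ≤ Ē →
    (∀ j, j < k → ∀ w, w ∈ FlowStep.Box γ₀ j →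
      FormatPlus (S j) (M j) (Uc j) (coords j) (m j) (χ j) (Φ j w) (ι j) (wrap j) (emb j) (πc j) E κ) →
    FormatPlus (S k) (M k) (Uc k) (coords k) (m k) (χ k) (fun n B => Φ k v n B - Φz k v n B) (ι k) (wrap k) (emb k)
      (πc k) (ρ * E) κ

/-- **PIECE (L♭) — the history channel at ONE fixed input scale `Ē'`, as an analytic family in the history multiplier.**  For every level
`k`, admissible `v` and every history format level `0 < E < Ē'` reached by ALL previous levels: there is a `z`-family `Ez : ℂ → Pieces` of
piece systems of member `k`, differentiable in `z` on the disc `|z| < Ē'/E` at every admissible coordinate point, (1.18)-bounded by the ONE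
constant `C` uniformly on the disc (Theorem 3's step OUTPUT bound at input scale `Ē'`: the scaled history `z·𝐄_k` has format `|z|·E < Ē'`),
vanishing at `z = 0` (no history ⇒ no response; k = 0: DN0 precheck `dChannel_zero_at_first_level'`), whose `z = 1` member is analytic,
local, volume-independent and represents `Φ k v − Φz k v` near `B = 0`.  (Print: [II] pp. 9, 15–16 — the history enters (2.14) only through
`V″ = V′` of (1.33), multiplied by the complex `τ(Y)` of (2.18); §1 above.) -/
def DChannelFlat (γ₀ Ē' C κ : ℝ) : Prop :=
  ∀ k v, v ∈ FlowStep.Box γ₀ k → ∀ E : ℝ, 0 < E → E < Ē' →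
    (∀ j, j < k → ∀ w, w ∈ FlowStep.Box γ₀ j →
      FormatPlus (S j) (M j) (Uc j) (coords j) (m j) (χ j) (Φ j w) (ι j) (wrap j) (emb j) (πc j) E κ) →
    ∃ Ez : ℂ → Pieces (S k) (M k),
      Analytic19 (Uc k) (Ez 1) ∧ Local17 (coords k) (Ez 1) ∧
      Repr17 (S k) (Ez 1) (χ k) (fun n B => Φ k v n B - Φz k v n B) (ι k) ∧
      PieceVolIndep (S k) (M k) (wrap k) (emb k) (πc k) (Ez 1) ∧
      (∀ n X u, u ∈ Uc k n X → DifferentiableOn ℂ (fun z => Ez z n X u) (Metric.ball 0 (Ē' / E))) ∧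
      (∀ z ∈ Metric.ball (0 : ℂ) (Ē' / E), Bound118 (S k) (Uc k) (Ez z) C κ) ∧
      (∀ n X u, u ∈ Uc k n X → Ez 0 n X u = 0)

/-- **(L♭) ⟹ (L)** with the `E`-free slope `ρ := C / Ē'`, on every closed range `0 < E ≤ Ē` with `Ē < Ē'` (CRIT-1 typing note (a)). -/
theorem dChannelContraction_of_flat {γ₀ Ē Ē' C κ : ℝ} (hĒ : Ē < Ē')
    (hF : DChannelFlat S M m Uc coords χ W Φ Φz ι wrap emb πc γ₀ Ē' C κ) :
    DChannelContraction S M m Uc coords χ W Φ Φz ι wrap emb πc γ₀ (C / Ē') Ē κ := by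
  intro k v hv E hE hEĒ hprev
  have hEĒ' : E < Ē' := lt_of_le_of_lt hEĒ hĒ
  obtain ⟨Ez, hA, hLoc, hR, hV, hd, hb, h0⟩ := hF k v hv E hE hEĒ' hprev
  have hR1 : 1 < Ē' / E := by rw [lt_div_iff₀ hE]; linarith
  have hB := bound118_of_schwarz (Uc k) Ez hR1 hd hb h0
  have hEq : C / (Ē' / E) = C / Ē' * E := by field_simp
  rw [hEq] at hB
  exact ⟨Ez 1, hA, hB, hLoc, hR, hV⟩

/-- **Conversely — (L) ⟹ (L♭)** with `Ē' := Ē`, `C := ρ·Ē`, by the TRIVIAL linear family `Ez := z·E₁` (CRIT-1's remark, HOME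
STATUS l.3594, in kernel): at STATEMENT level (L♭) ≅ (L); (L♭)'s value is as the PROOF ROUTE (the genuine complexified-history family
gets `C` from Theorem 3's output bound at ONE scale, no re-counting), not as a different item — the filed text `PortZeroInputSplitZD`
(№442) in the (Z) ∧ (L) form is the item, ZD♭ its named sub-line. -/
theorem flat_of_dChannelContraction {γ₀ ρ Ē κ : ℝ}
    (hL : DChannelContraction S M m Uc coords χ W Φ Φz ι wrap emb πc γ₀ ρ Ē κ) :
    DChannelFlat S M m Uc coords χ W Φ Φz ι wrap emb πc γ₀ Ē (ρ * Ē) κ := by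
  intro k v hv E hE hEĒ hprev
  obtain ⟨P, hA, hB, hLoc, hR, hV⟩ := hL k v hv E hE hEĒ.le hprev
  have hĒ0 : 0 ≤ Ē := (hE.trans hEĒ).le
  have hEne : E ≠ 0 := hE.ne'
  refine ⟨fun z n X u => z * P n X u, ?_, ?_, ?_, ?_, ?_, ?_, ?_⟩
  · intro n X
    simpa only [one_mul] using hA n X
  · intro n X u u' h
    simpa only [one_mul] using hLoc n X u u' h
  · intro n
    simpa only [one_mul] using hR n
  · intro n X hX u'
    simpa only [one_mul] using hV n X hX u'
  · intro n X u _
    exact (differentiable_id.mul (differentiable_const _)).differentiableOn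
  · intro z hz n X u hu
    rw [Metric.mem_ball, dist_zero_right] at hz
    show ‖z * P n X u‖ ≤ ρ * Ē * Real.exp (-κ * (S k n).dj X)
    rw [norm_mul]
    calc ‖z‖ * ‖P n X u‖ ≤ (Ē / E) * (ρ * E * Real.exp (-κ * (S k n).dj X)) :=
          mul_le_mul hz.le (hB n X u hu) (norm_nonneg _) (div_nonneg hĒ0 hE.le)
      _ = ρ * Ē * Real.exp (-κ * (S k n).dj X) := by
          field_simp
  · intro n X u _
    exact zero_mul _

/-- **(L♭) and (L) are the same ITEM up to constants** (kernel both ways). -/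
theorem flat_iff_contraction_upTo {γ₀ κ : ℝ} :
    (∃ ρ Ē, 0 ≤ ρ ∧ ρ < 1 ∧ 0 < Ē ∧ DChannelContraction S M m Uc coords χ W Φ Φz ι wrap emb πc γ₀ ρ Ē κ) ↔
    (∃ Ē Ē' C, 0 ≤ C ∧ 0 < Ē ∧ Ē < Ē' ∧ C < Ē' ∧
      DChannelFlat S M m Uc coords χ W Φ Φz ι wrap emb πc γ₀ Ē' C κ ∧
      DChannelContraction S M m Uc coords χ W Φ Φz ι wrap emb πc γ₀ (C / Ē') Ē κ) := by
  constructor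
  · rintro ⟨ρ, Ē, hρ, hρ1, hĒ, hL⟩
    -- restrict (L) from `Ē` to `Ē/2 < Ē`, complexify at scale `Ē`
    refine ⟨Ē / 2, Ē, ρ * Ē, mul_nonneg hρ hĒ.le, by linarith, by linarith, ?_, flat_of_dChannelContraction S M m Uc coords χ W Φ Φz ι wrap emb πc hL, ?_⟩
    · calc ρ * Ē < 1 * Ē := mul_lt_mul_of_pos_right hρ1 hĒ
        _ = Ē := one_mul Ē
    · have hq : ρ * Ē / Ē = ρ := by field_simp
      rw [hq]
      intro k v hv E hE hEĒ hprev
      exact hL k v hv E hE (by linarith) hprev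
  · rintro ⟨Ē, Ē', C, hC, hĒ, hĒĒ, hCĒ, -, hL⟩
    have hĒ' : 0 < Ē' := hĒ.trans hĒĒ
    exact ⟨C / Ē', Ē, div_nonneg hC hĒ'.le, (div_lt_one hĒ').2 hCĒ, hĒ, hL⟩

/-- The glue (twin of v7 `uniformFormat_of_split`, full-memory Grönwall): (Z) with `σ > 0`, (L) with `(ρ, Ē)`, `ρ < 1`, closure
`σ ≤ (1 − ρ)·Ē` ⟹ the wall's body with `E₀ := σ / (1 − ρ)`. -/
theorem uniformFormat_of_split {γ₀ σ ρ Ē κ : ℝ} (hσ : 0 < σ) (hρ1 : ρ < 1) (hcl : σ ≤ (1 - ρ) * Ē)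
    (hZ : ZeroInputFormat S M m Uc coords χ W Φz ι wrap emb πc γ₀ σ κ)
    (hL : DChannelContraction S M m Uc coords χ W Φ Φz ι wrap emb πc γ₀ ρ Ē κ) :
    UniformFormat S M m Uc coords χ W Φ ι wrap emb πc γ₀ (σ / (1 - ρ)) κ := by
  have h1ρ : 0 < 1 - ρ := by linarith
  have hE0 : 0 < σ / (1 - ρ) := div_pos hσ h1ρ
  have hEbar : σ / (1 - ρ) ≤ Ē := by
    rw [div_le_iff₀ h1ρ]
    linarith
  have hne : 1 - ρ ≠ 0 := h1ρ.ne'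
  have hconst : σ + ρ * (σ / (1 - ρ)) = σ / (1 - ρ) := by
    field_simp
    ring
  intro k
  induction k using Nat.strong_induction_on with
  | h k ih =>
    intro v hv
    have hD := hL k v hv (σ / (1 - ρ)) hE0 hEbar (fun j hj w hw => ih j hj w hw)
    have h := formatPlus_of_split (hZ k v hv) hD
    rw [hconst] at h
    exact h

/-- **THE FLAT SPLIT, ITEM-SHAPED**: ONE existential over `(σ, Ē, Ē', C)` with the guards, the closure (print: R23 at scale `Ē'`, §1
`schwarzSlope_le_one_iff`) and the two conjuncts (Z) ∧ (L♭). -/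
def FlatSplitItem (γ₀ κ : ℝ) : Prop :=
  ∃ σ Ē Ē' C : ℝ, 0 < σ ∧ 0 ≤ C ∧ 0 < Ē ∧ Ē < Ē' ∧ C < Ē' ∧ σ ≤ (1 - C / Ē') * Ē ∧
    ZeroInputFormat S M m Uc coords χ W Φz ι wrap emb πc γ₀ σ κ ∧
    DChannelFlat S M m Uc coords χ W Φ Φz ι wrap emb πc γ₀ Ē' C κ

/-- **Flat split ⟹ the wall's item** (`∃ E₀ ≥ 0, UniformFormat … E₀`), with `E₀ := σ / (1 − C/Ē')`. -/
theorem wall_of_flatSplitItem {γ₀ κ : ℝ} (h : FlatSplitItem S M m Uc coords χ W Φ Φz ι wrap emb πc γ₀ κ) :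
    ∃ E₀ : ℝ, 0 ≤ E₀ ∧ UniformFormat S M m Uc coords χ W Φ ι wrap emb πc γ₀ E₀ κ := by
  obtain ⟨σ, Ē, Ē', C, hσ, hC, hĒ, hĒĒ, hCĒ, hcl, hZ, hF⟩ := h
  have hĒ' : 0 < Ē' := hĒ.trans hĒĒ
  have hρ1 : C / Ē' < 1 := by rw [div_lt_one hĒ']; exact hCĒ
  have hL := dChannelContraction_of_flat S M m Uc coords χ W Φ Φz ι wrap emb πc hĒĒ hF
  exact ⟨σ / (1 - C / Ē'), div_nonneg hσ.le (by linarith),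
    uniformFormat_of_split S M m Uc coords χ W Φ Φz ι wrap emb πc hσ hρ1 hcl hZ hL⟩

end Flat

/-! ## §3. Record side: the REAL interpolation of the history through the one step functional (anchor of the `z`-family) -/

section Record

open Literature.MathematicalPhysics.QuantumFieldTheory.Balaban1983to89.Node00
open B12Eq019ActionBody (nextAction)
open T4Continuum (T4Family)

variable (F : T4Family) (N : ℕ) [NeZero N]

/-- Print's MAIN TERM `−(1/g_k²)A(U_k(V))` (twin of DN0 precheck `mainTermT`). [cite: Balaban1987RG1, (1.3) p.260] -/
def mainTermT (ε : ℝ) (K : ℕ) (g : ℕ → ℝ) (k : ℕ) : Density (F.P K) k (SU N) :=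
  fun V => -(1 / (g k) ^ 2) * wilsonAction4 (Uk F N K k ε V)

/-- 𝐄_k := A_k + (1/g_k²)A(U_k) (twin of DN0 precheck `EkT`). [cite: Balaban1987RG1, (0.22) p.256] -/
def EkT (T : Transport F N) (χ : (K : ℕ) → (ℕ → ℝ) → (k : ℕ) → Density (F.P K) k (SU N)) (ε : ℝ) (K : ℕ) (g : ℕ → ℝ)
    (k : ℕ) : Density (F.P K) k (SU N) :=
  fun V => effActionHT F N T χ K g k V + (1 / (g k) ^ 2) * wilsonAction4 (Uk F N K k ε V)

/-- `A_k = A⁰_k + 𝐄_k` as densities. [cite: Balaban1987RG1, (0.22) p.256 (bookkeeping)] -/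
theorem effActionHT_eq_main_add_Ek (T : Transport F N) (χ : (K : ℕ) → (ℕ → ℝ) → (k : ℕ) → Density (F.P K) k (SU N)) (ε : ℝ)
    (K : ℕ) (g : ℕ → ℝ) (k : ℕ) : effActionHT F N T χ K g k = mainTermT F N ε K g k + EkT F N T χ ε K g k := by
  funext V
  show effActionHT F N T χ K g k V = mainTermT F N ε K g k V + EkT F N T χ ε K g k V
  unfold mainTermT EkT
  ring

/-- The ONE-STEP functional of record with EXPLICIT input action `R_k(A)(W) := 𝐓_k(A)(W) − A(Ū^k U_{k+1} W)` (twin of DN0 precheck `stepOutT`).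
[cite: Balaban1987RG1, (0.19) p.255, (1.6) p.261] -/
def stepOutT (T : Transport F N) (χ : (K : ℕ) → (ℕ → ℝ) → (k : ℕ) → Density (F.P K) k (SU N)) (ε : ℝ) (K : ℕ) (g : ℕ → ℝ)
    (k : ℕ) (A : Density (F.P K) k (SU N)) (W : GaugeField (F.P K) (k + 1) (SU N)) : ℝ :=
  nextAction (T K k) (χ K g k) (gfOfRecord F N K k) (g k) A W - A (Averaging.iter (avOfRecord F N K) k (Uk F N K (k + 1) ε W))

/-- **The REAL history interpolation** `t ↦ R_k(A⁰_k + t·𝐄_k)(W)`: the record's step at the history multiplied by a real `t`.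
[cite: Balaban1987RG1, (1.6) p.261 (bookkeeping)] -/
def histInterpT (T : Transport F N) (χ : (K : ℕ) → (ℕ → ℝ) → (k : ℕ) → Density (F.P K) k (SU N)) (ε : ℝ) (K : ℕ)
    (g : ℕ → ℝ) (k : ℕ) (t : ℝ) (W : GaugeField (F.P K) (k + 1) (SU N)) : ℝ :=
  stepOutT F N T χ ε K g k (mainTermT F N ε K g k + t • EkT F N T χ ε K g k) W

/-- At `t = 1` the interpolation IS the merged term 𝓝_{k+1} of record ((1.6)). [cite: Balaban1987RG1, (1.6) p.261 (bookkeeping)] -/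
theorem histInterpT_one (T : Transport F N) (χ : (K : ℕ) → (ℕ → ℝ) → (k : ℕ) → Density (F.P K) k (SU N)) (ε : ℝ) (K : ℕ)
    (g : ℕ → ℝ) (k : ℕ) (W : GaugeField (F.P K) (k + 1) (SU N)) :
    histInterpT F N T χ ε K g k 1 W = mergedTermT F N T χ ε K g k W := by
  unfold histInterpT stepOutT mergedTermT
  rw [one_smul, ← effActionHT_eq_main_add_Ek, effActionHT_succ]

/-- At `t = 0` it is the ZERO-INPUT output 𝓝⁰_{k+1} := R_k(A⁰_k) (DN0 precheck `zeroInputMergedTermT`, there by `rfl`). [cite: Balaban1987RG1, (1.6) p.261 (bookkeeping)] -/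
theorem histInterpT_zero (T : Transport F N) (χ : (K : ℕ) → (ℕ → ℝ) → (k : ℕ) → Density (F.P K) k (SU N)) (ε : ℝ) (K : ℕ)
    (g : ℕ → ℝ) (k : ℕ) (W : GaugeField (F.P K) (k + 1) (SU N)) :
    histInterpT F N T χ ε K g k 0 W = stepOutT F N T χ ε K g k (mainTermT F N ε K g k) W := by
  unfold histInterpT
  rw [zero_smul, add_zero]

/-- **The interpolated HISTORY CHANNEL** `𝓓_{k+1}(t) := R_k(A⁰_k + t·𝐄_k) − R_k(A⁰_k)`. [cite: Balaban1987RG1, (1.6) p.261 (bookkeeping)] -/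
def dChannelInterpT (T : Transport F N) (χ : (K : ℕ) → (ℕ → ℝ) → (k : ℕ) → Density (F.P K) k (SU N)) (ε : ℝ) (K : ℕ)
    (g : ℕ → ℝ) (k : ℕ) (t : ℝ) (W : GaugeField (F.P K) (k + 1) (SU N)) : ℝ :=
  histInterpT F N T χ ε K g k t W - histInterpT F N T χ ε K g k 0 W

/-- It VANISHES at `t = 0` (the `z = 0` anchor of (L♭)). -/
theorem dChannelInterpT_zero (T : Transport F N) (χ : (K : ℕ) → (ℕ → ℝ) → (k : ℕ) → Density (F.P K) k (SU N)) (ε : ℝ)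
    (K : ℕ) (g : ℕ → ℝ) (k : ℕ) (W : GaugeField (F.P K) (k + 1) (SU N)) :
    dChannelInterpT F N T χ ε K g k 0 W = 0 :=
  sub_self _

/-- At `t = 1` it is the history channel `𝓝_{k+1} − 𝓝⁰_{k+1}` of the split (the `z = 1` anchor of (L♭)). -/
theorem dChannelInterpT_one (T : Transport F N) (χ : (K : ℕ) → (ℕ → ℝ) → (k : ℕ) → Density (F.P K) k (SU N)) (ε : ℝ)
    (K : ℕ) (g : ℕ → ℝ) (k : ℕ) (W : GaugeField (F.P K) (k + 1) (SU N)) :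
    dChannelInterpT F N T χ ε K g k 1 W =
      mergedTermT F N T χ ε K g k W - stepOutT F N T χ ε K g k (mainTermT F N ε K g k) W := by
  rw [dChannelInterpT, histInterpT_one, histInterpT_zero]

/-- The input of the interpolation is AFFINE in `t` (so every functional of the input that is analytic in the action is analytic in `t`;
the complex extension `t ↦ z` is what (L♭) quantifies over). -/
theorem histInput_affine (T : Transport F N) (χ : (K : ℕ) → (ℕ → ℝ) → (k : ℕ) → Density (F.P K) k (SU N)) (ε : ℝ) (K : ℕ)
    (g : ℕ → ℝ) (k : ℕ) (s t : ℝ) :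
    mainTermT F N ε K g k + (s + t) • EkT F N T χ ε K g k =
      (mainTermT F N ε K g k + s • EkT F N T χ ε K g k) + t • EkT F N T χ ε K g k := by
  rw [add_smul, add_assoc]

end Record

/-! ## §4. Models: the flat split fires non-vacuously (Toy D); the wall does not inhabit it (Toy A♭) -/

section Toys

/-- One localization domain of tree length `0` (twin of v7). -/
abbrev toyS : ℕ → LocDomainSys := fun _ => { Dom := Unit, dj := fun _ => 0, dj_nonneg := fun _ => le_rfl }
/-- No coordinates. -/
abbrev toyM : ℕ → ℕ := fun _ => 0
/-- The whole coordinate space. -/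
abbrev toyUc : (n : ℕ) → (toyS n).Dom → Set (Fin (toyM n) → ℂ) := fun _ _ => Set.univ
/-- No coordinates «in X». -/
abbrev toyCoords : (n : ℕ) → (toyS n).Dom → Finset (Fin (toyM n)) := fun _ _ => ∅
/-- Chart dimension `0`. -/
abbrev toym : ℕ → ℕ := fun _ => 0
/-- Identity chart. -/
abbrev toyχ : (n : ℕ) → (toyS n).Dom → (Fin (toym n) → ℂ) → (Fin (toyM n) → ℂ) := fun _ _ u => u
/-- `B : ℂ` ↦ the empty coordinate vector. -/
abbrev toyι : (n : ℕ) → ℂ → (Fin (toym n) → ℂ) := fun _ _ => ![]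
/-- No wrapping domains. -/
abbrev toyWrap : (n : ℕ) → Finset (toyS n).Dom := fun _ => ∅
/-- Identity domain embedding. -/
abbrev toyEmb : (n : ℕ) → (toyS n).Dom → (toyS (n + 1)).Dom := fun _ X => X
/-- Identity coordinate projection. -/
abbrev toyπc : (n : ℕ) → (toyS n).Dom → (Fin (toyM (n + 1)) → ℂ) → (Fin (toyM n) → ℂ) := fun _ _ u => u
/-- Constant functional. -/
abbrev constFun (c : ℝ) : (n : ℕ) → ℂ → ℂ := fun _ _ => (c : ℂ)

/-- The mould on the toy data is `|c| ≤ E₀` (twin of v7 `toy_formatPlus_iff`). -/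
theorem toy_formatPlus_iff (c E₀ κ : ℝ) :
    FormatPlus toyS toyM toyUc toyCoords toym toyχ (W := fun _ => ℂ) (constFun c) toyι toyWrap toyEmb toyπc E₀ κ ↔
      |c| ≤ E₀ := by
  constructor
  · rintro ⟨P, -, hB, -, hR, -⟩
    have h0 := (hR 0).self_of_nhds
    rw [Fintype.sum_unique] at h0
    have h2 := hB 0 default (toyχ 0 default (toyι 0 0)) (Set.mem_univ _)
    rw [← h0] at h2
    simpa using h2
  · intro hc
    refine ⟨fun _ _ _ => (c : ℂ), ?_, ?_, ?_, ?_, ?_⟩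
    · intro n X
      exact analyticOnNhd_const
    · intro n X u _
      simpa using hc
    · intro n X u u' _
      rfl
    · intro n
      exact Filter.Eventually.of_forall fun B => by simp
    · intro n X _ u'
      rfl

/-- Level-indexed toy data. -/
abbrev lvS : ℕ → ℕ → LocDomainSys := fun _ => toyS
/-- idem -/
abbrev lvM : ℕ → ℕ → ℕ := fun _ => toyM
/-- idem -/
abbrev lvm : ℕ → ℕ → ℕ := fun _ => toym
/-- idem -/
abbrev lvUc : (k n : ℕ) → (lvS k n).Dom → Set (Fin (lvM k n) → ℂ) := fun _ => toyUc
/-- idem -/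
abbrev lvCoords : (k n : ℕ) → (lvS k n).Dom → Finset (Fin (lvM k n)) := fun _ => toyCoords
/-- idem -/
abbrev lvχ : (k n : ℕ) → (lvS k n).Dom → (Fin (lvm k n) → ℂ) → (Fin (lvM k n) → ℂ) := fun _ => toyχ
/-- idem -/
abbrev lvW : ℕ → ℕ → Type := fun _ _ => ℂ
/-- idem -/
abbrev lvι : (k n : ℕ) → lvW k n → (Fin (lvm k n) → ℂ) := fun _ => toyι
/-- idem -/
abbrev lvWrap : (k n : ℕ) → Finset (lvS k n).Dom := fun _ => toyWrap
/-- idem -/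
abbrev lvEmb : (k n : ℕ) → (lvS k n).Dom → (lvS k (n + 1)).Dom := fun _ => toyEmb
/-- idem -/
abbrev lvπc : (k n : ℕ) → (lvS k n).Dom → (Fin (lvM k (n + 1)) → ℂ) → (Fin (lvM k n) → ℂ) := fun _ => toyπc

/-- The level functional with value `N k` at level `k`. -/
abbrev seqFun (N : ℕ → ℝ) : (k : ℕ) → (Fin (k + 1) → ℝ) → (n : ℕ) → lvW k n → ℂ := fun k _ _ _ => (N k : ℂ)

/-- The mould at level `k` for the sequence functional is `|N k| ≤ E`. -/
theorem lv_formatPlus_iff (N : ℕ → ℝ) (k : ℕ) (v : Fin (k + 1) → ℝ) (E κ : ℝ) :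
    FormatPlus (lvS k) (lvM k) (lvUc k) (lvCoords k) (lvm k) (lvχ k) (seqFun N k v) (lvι k) (lvWrap k) (lvEmb k) (lvπc k)
        E κ ↔ |N k| ≤ E :=
  toy_formatPlus_iff (N k) E κ

/-- A constant admissible history. -/
theorem const_mem_box {γ₀ : ℝ} (hγ : 0 < γ₀) (k : ℕ) : (fun _ => γ₀ : Fin (k + 1) → ℝ) ∈ FlowStep.Box γ₀ k := by
  intro i _
  exact Set.mem_Ioc.2 ⟨hγ, le_rfl⟩

/-- The linear `z`-family of toy piece systems with slope `d`: `Ez z := z·d` (one domain, no coordinates). -/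
abbrev linPieces (d : ℝ) : ℂ → Pieces toyS toyM := fun z _ _ _ => z * (d : ℂ)

/-! ### Toy D: (Z), (L♭), the flat item hold non-vacuously; the chain fires -/

/-- Total sizes: `1` at level `0`, `5/4` after. -/
def ND : ℕ → ℝ := fun k => if k = 0 then 1 else 5 / 4
/-- Zero-input sizes: `1`. -/
def ZD : ℕ → ℝ := fun _ => 1

/-- (Z) for Toy D with `σ = 1`. -/
theorem toyD_zeroInput (γ₀ κ : ℝ) :
    ZeroInputFormat lvS lvM lvm lvUc lvCoords lvχ lvW (seqFun ZD) lvι lvWrap lvEmb lvπc γ₀ 1 κ := by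
  intro k v _
  rw [lv_formatPlus_iff]
  simp [ZD]

/-- **(L♭) for Toy D, NON-VACUOUSLY**: `Ē' = 4`, `C = 1`; at level `0` the response family is `0`; at level `k ≥ 1` it is `z ↦ z/4`,
bounded by `1` on the disc `|z| < 4/E` because the previous-level hypothesis at level `0` forces `E ≥ 1`. -/
theorem toyD_flat {γ₀ : ℝ} (hγ : 0 < γ₀) (κ : ℝ) :
    DChannelFlat lvS lvM lvm lvUc lvCoords lvχ lvW (seqFun ND) (seqFun ZD) lvι lvWrap lvEmb lvπc γ₀ 4 1 κ := by
  intro k v hv E hE hE4 hprev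
  by_cases hk : k = 0
  · subst hk
    refine ⟨linPieces 0, ?_, ?_, ?_, ?_, ?_, ?_, ?_⟩
    · intro n X; exact analyticOnNhd_const
    · intro n X u u' _; rfl
    · intro n; exact Filter.Eventually.of_forall fun B => by simp [seqFun, ND, ZD]
    · intro n X _ u'; rfl
    · intro n X u _; exact (differentiable_id.mul (differentiable_const _)).differentiableOn
    · intro z _ n X u _
      show ‖z * ((0 : ℝ) : ℂ)‖ ≤ 1 * Real.exp (-κ * 0)
      simp
    · intro n X u _; simp
  · have hE1 : 1 ≤ E := by
      have h := hprev 0 (Nat.pos_of_ne_zero hk) (fun _ => γ₀) (const_mem_box hγ 0)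
      rw [lv_formatPlus_iff] at h
      simpa [ND] using h
    refine ⟨linPieces (1 / 4), ?_, ?_, ?_, ?_, ?_, ?_, ?_⟩
    · intro n X; exact analyticOnNhd_const
    · intro n X u u' _; rfl
    · intro n
      exact Filter.Eventually.of_forall fun B => by
        simp [seqFun, ND, ZD, hk]
        norm_num
    · intro n X _ u'; rfl
    · intro n X u _; exact (differentiable_id.mul (differentiable_const _)).differentiableOn
    · intro z hz n X u _
      show ‖z * ((1 / 4 : ℝ) : ℂ)‖ ≤ 1 * Real.exp (-κ * 0)
      rw [Metric.mem_ball, dist_zero_right] at hz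
      have hz4 : ‖z‖ < 4 := by
        have h4E : 4 / E ≤ 4 := by
          rw [div_le_iff₀ hE]; linarith
        exact lt_of_lt_of_le hz h4E
      rw [norm_mul]
      have : ‖((1 / 4 : ℝ) : ℂ)‖ = 1 / 4 := by
        rw [Complex.norm_real]; norm_num
      rw [this]
      simp only [mul_zero, Real.exp_zero, mul_one]
      linarith
    · intro n X u _; simp

/-- The flat item for Toy D: `σ = 1`, `Ē = 2`, `Ē' = 4`, `C = 1` (slope `1/4`, closure `1 ≤ (3/4)·2`). -/
theorem toyD_flatSplitItem {γ₀ : ℝ} (hγ : 0 < γ₀) (κ : ℝ) :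
    FlatSplitItem lvS lvM lvm lvUc lvCoords lvχ lvW (seqFun ND) (seqFun ZD) lvι lvWrap lvEmb lvπc γ₀ κ :=
  ⟨1, 2, 4, 1, one_pos, zero_le_one, two_pos, by norm_num, by norm_num, by norm_num, toyD_zeroInput γ₀ κ, toyD_flat hγ κ⟩

/-- … hence the wall for Toy D, BY THE CHAIN (rule (N): the glue fires on a non-vacuous instance). -/
theorem toyD_wall {γ₀ : ℝ} (hγ : 0 < γ₀) (κ : ℝ) :
    ∃ E₀ : ℝ, 0 ≤ E₀ ∧ UniformFormat lvS lvM lvm lvUc lvCoords lvχ lvW (seqFun ND) lvι lvWrap lvEmb lvπc γ₀ E₀ κ :=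
  wall_of_flatSplitItem lvS lvM lvm lvUc lvCoords lvχ lvW (seqFun ND) (seqFun ZD) lvι lvWrap lvEmb lvπc (toyD_flatSplitItem hγ κ)

/-! ### Toy A♭: the wall and (Z) hold, the flat item FAILS — the wall does not inhabit (L♭) -/

/-- Total sizes: `1` at level `0`, `2` after (v7's Toy A). -/
def NA : ℕ → ℝ := fun k => if k = 0 then 1 else 2
/-- Zero-input sizes: `1`. -/
def ZA : ℕ → ℝ := fun _ => 1

/-- The wall holds for Toy A♭ with `E₀ = 2`. -/
theorem toyA_wall (γ₀ κ : ℝ) : UniformFormat lvS lvM lvm lvUc lvCoords lvχ lvW (seqFun NA) lvι lvWrap lvEmb lvπc γ₀ 2 κ := by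
  intro k v _
  rw [lv_formatPlus_iff]
  by_cases hk : k = 0 <;> simp [NA, hk]

/-- (Z) holds for Toy A♭ with `σ = 1`. -/
theorem toyA_zeroInput (γ₀ κ : ℝ) :
    ZeroInputFormat lvS lvM lvm lvUc lvCoords lvχ lvW (seqFun ZA) lvι lvWrap lvEmb lvπc γ₀ 1 κ := by
  intro k v _
  rw [lv_formatPlus_iff]
  simp [ZA]

/-- **The flat item FAILS for Toy A♭** although the wall and (Z) hold: at level `1` with `E = 1` a response family bounded by `C < Ē'` on
the disc of radius `Ē'` and vanishing at `0` has `|response(1)| ≤ C/Ē' < 1` by Schwarz — but the response is `2 − 1 = 1`. -/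
theorem toyA_not_flatSplitItem {γ₀ : ℝ} (hγ : 0 < γ₀) (κ : ℝ) :
    ¬ FlatSplitItem lvS lvM lvm lvUc lvCoords lvχ lvW (seqFun NA) (seqFun ZA) lvι lvWrap lvEmb lvπc γ₀ κ := by
  rintro ⟨σ, Ē, Ē', C, hσ, hC, hĒ, hĒĒ, hCĒ, hcl, hZ, hF⟩
  have hĒ' : 0 < Ē' := hĒ.trans hĒĒ
  -- (Z) at level 0 forces σ ≥ 1, the closure then forces Ē ≥ 1, hence Ē' > 1
  have hσ1 : 1 ≤ σ := by
    have h := hZ 0 (fun _ => γ₀) (const_mem_box hγ 0)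
    rw [lv_formatPlus_iff] at h
    simpa [ZA] using h
  have hρ0 : 0 ≤ C / Ē' := div_nonneg hC hĒ'.le
  have hĒ1 : 1 ≤ Ē := by nlinarith
  have hĒ'1 : 1 < Ē' := lt_of_le_of_lt hĒ1 hĒĒ
  -- (L♭) at level 1, E = 1 (the level-0 hypothesis |NA 0| = 1 ≤ 1 holds)
  have hprev : ∀ j, j < 1 → ∀ w, w ∈ FlowStep.Box γ₀ j →
      FormatPlus (lvS j) (lvM j) (lvUc j) (lvCoords j) (lvm j) (lvχ j) (seqFun NA j w) (lvι j) (lvWrap j) (lvEmb j)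
        (lvπc j) 1 κ := by
    intro j hj w _
    have hj0 : j = 0 := by omega
    subst hj0
    rw [lv_formatPlus_iff]
    simp [NA]
  obtain ⟨Ez, -, -, hR, -, hd, hb, h0⟩ := hF 1 (fun _ => γ₀) (const_mem_box hγ 1) 1 one_pos hĒ'1 hprev
  have hR1 : 1 < Ē' / 1 := by rw [div_one]; exact hĒ'1
  have hS := bound118_of_schwarz (lvUc 1) Ez hR1 hd hb h0
  -- the represented value at z = 1 is NA 1 − ZA 1 = 1
  have hrep := (hR 0).self_of_nhds
  rw [Fintype.sum_unique] at hrep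
  have hval : Ez 1 0 default (lvχ 1 0 default (lvι 1 0 0)) = 1 := by
    rw [← hrep]
    simp [seqFun, NA, ZA]
    norm_num
  have hb1 := hS 0 default (lvχ 1 0 default (lvι 1 0 0)) (Set.mem_univ _)
  rw [hval, div_one] at hb1
  have hlt : C / Ē' < 1 := by rw [div_lt_one hĒ']; exact hCĒ
  have : (1 : ℝ) ≤ C / Ē' := by simpa using hb1
  linarith

end Toys

end

end Summit.QuantumFields.YangMills.Cruxes.Record13SepCoPHInhabited.Lens2G5
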